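import Summits.CriticalPhenomena.PercolationContinuityZ3.Theorems.PercNearOneGluingNoHeavyLowerTailThreePointProductFormFibreFlat
import HarnessLib

/-!
# The product form `#bad² ≤ #P1·#P2` in the fibre language: the CUT-VERTEX THEOREM
# (Sahi programme, prover prim-sahi-p2 gen 54)

Support file (`--supports stmt-CriticalPhenomena-4575`, helper); continues `…ThreePointProductFormFibreFlat` (the flat `♭z = clusterFlip ends a z̄`
is injective; the two-point fact `V ≤ Cn`, `V ≤ Dn`).  Standard axioms, no sorries, no named facts, no definitions.
Memo `run/shared/lean/prim/prim-sahi/FROM-prim-sahi-p2-gen53-PRODUCT-FORM.md` §2 (paper proof) and gen 54 memo §8.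

SETTING.  A finite multigraph `(V, α, ends)`, an apex `a`, and a vertex set `S` with `a ∉ S` which `a` SEPARATES from the rest: every label
has all its endpoints in `S ∪ {a}` or all its endpoints in `Sᶜ ∪ {a}` (hypothesis spelled out in every statement; `separates_compl`: it is
symmetric in `S ↔ (S ∪ {a})ᶜ`).  Terminals `s ∈ S` and
`c ∉ S`, `c ≠ a`.  Write `R z x y` for open connection in `z : α → Bool` and `♭z = clusterFlip ends a (fun l => !z l)`.
* `support_subset_of_walk` [this work] — an open walk starting in `S` and avoiding `a` stays in `S`; hence **`reachable_apex_of_reachable`**: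
  `R z s c → R z s a ∧ R z a c` (every `s–c` connection passes through the cut vertex), and `reachable_iff_of_agree_inside` — LOCALITY: `R z a v`
  for `v ∈ S` depends only on the non-loop labels inside `S ∪ {a}` (a path from `a` into `S` stays in `S ∪ {a}`).
* `flat_apply_eq_of_agree`, `virtual_iff_of_agree` [this work] — the flat respects the separation: if `z, z'` agree on the non-loop labels
  inside `S ∪ {a}`, so do `♭z, ♭z'`, hence the 'virtually joined' event `{a ↮ v in z, a ↔ v in ♭z}` (`v ∈ S`) is determined inside.
* `card_and_mul_card_univ` [this work] — INDEPENDENCE COUNT: if `E₁` depends only on the labels satisfying `ins` and `E₂` only on the others,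
  `#(E₁ ∩ E₂) · #univ = #E₁ · #E₂` (explicit bijection of pairs, no product types).
* **`productForm_of_separates`** [this work] — THE CUT-VERTEX THEOREM: `#bad² ≤ #P1 · #P2` whenever `a` separates `s` from `c`, where
  `bad = {z : a ↮ s, a ↮ c, s ↮ c in z, s ↔ c in ♭z}`, `P1 = {a ↔ s, a ↮ c}`, `P2 = {a ↔ c, a ↮ s}`.  Proof (gen 53 §2): by the separation,
  `bad = E₁ ∩ E₂` with `E₁ = {a ↮ s in z, a ↔ s in ♭z}` (determined inside `S ∪ {a}`) and `E₂` the same for `c` (determined outside), `P1 = {a ↔ s} ∩ {a ↮ c}`,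
  `P2 = {a ↮ s} ∩ {a ↔ c}`; the independence count turns the four cardinalities into products and the two-point facts
  `#E₁ ≤ #{a ↔ s}`, `#E₁ ≤ #{a ↮ s}` (`…FibreFlat`) finish: `(#E₁ #E₂)² ≤ (#{a↔s} #{a↮s}) (#{a↔c} #{a↮c})`.
[folklore] (walks through a cut vertex; product counting); [cite: Gladkov2024, Conjecture 10.1 (p. 18), arXiv:2408.08457] for CONJECTURE (P).
-/

namespace Summit.CriticalPhenomena.PercolationContinuityZ3.Theorems.ProductFormFibre

open Finset Literature.Probability.Percolation
open Summit.CriticalPhenomena.PercolationContinuityZ3.Theorems.ThreePointCPIClusterSwap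
  (CReach QTouch clusterFlip clusterFlip_of_qtouch clusterFlip_of_not_qtouch)

variable {V α : Type*}

/-! ### 1. Walks and the cut vertex -/

section Separator

variable (ends : α → Sym2 V) (a : V) (S : Set V)

/-- Every label lies inside `S ∪ {a}` or inside `(S ∪ {a})ᶜ ∪ {a}`: the apex `a` separates `S` from the rest.  (Spelled out; no definition.) -/
theorem separates_elim {l : α} (hsep : ∀ l : α, (∀ v ∈ ends l, v ∈ S ∨ v = a) ∨ (∀ v ∈ ends l, v ∉ S ∨ v = a))
    {u w : V} (hl : ends l = s(u, w)) (hu : u ∈ S) (hua : u ≠ a) : w ∈ S ∨ w = a := by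
  rcases hsep l with h | h
  · exact h w (by rw [hl]; exact Sym2.mem_mk_right u w)
  · rcases h u (by rw [hl]; exact Sym2.mem_mk_left u w) with h' | h'
    · exact absurd hu h'
    · exact absurd h' hua

/-- One open step from a vertex of `S` (other than `a`) lands in `S ∪ {a}`. [this work] -/
theorem mem_or_eq_of_adj (hsep : ∀ l : α, (∀ v ∈ ends l, v ∈ S ∨ v = a) ∨ (∀ v ∈ ends l, v ∉ S ∨ v = a)) (haS : a ∉ S)
    (z : α → Bool) {u w : V} (hadj : (openGraph (labelledOpen ends z)).Adj u w) (hu : u ∈ S) : w ∈ S ∨ w = a := by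
  rw [openGraph_adj] at hadj
  obtain ⟨⟨l, -, hl⟩, -⟩ := hadj
  exact separates_elim ends a S hsep hl hu (fun h => haS (h ▸ hu))

/-- **An open walk that starts in `S` and avoids `a` stays in `S`.** [this work] -/
theorem support_subset_of_walk (hsep : ∀ l : α, (∀ v ∈ ends l, v ∈ S ∨ v = a) ∨ (∀ v ∈ ends l, v ∉ S ∨ v = a)) (haS : a ∉ S)
    (z : α → Bool) : ∀ {u w : V} (p : (openGraph (labelledOpen ends z)).Walk u w), u ∈ S → a ∉ p.support →
      ∀ x ∈ p.support, x ∈ S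
  | _, _, .nil, hu, _, x, hx => by
      rw [SimpleGraph.Walk.support_nil, List.mem_singleton] at hx
      exact hx ▸ hu
  | u, _, .cons (v := v) h p, hu, ha, x, hx => by
      rw [SimpleGraph.Walk.support_cons, List.mem_cons] at hx ha
      have hv : v ∈ S := by
        rcases mem_or_eq_of_adj ends a S hsep haS z h hu with hv | hv
        · exact hv
        · exact absurd (Or.inr (hv ▸ p.start_mem_support)) ha
      rcases hx with rfl | hx
      · exact hu
      · exact support_subset_of_walk hsep haS z p hv (fun h' => ha (Or.inr h')) x hx

/-- **Every open `s–c` connection passes through the cut vertex**: `R z s c → R z s a ∧ R z a c` for `s ∈ S`, `c ∉ S`. [this work] -/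
theorem reachable_apex_of_reachable [DecidableEq V]
    (hsep : ∀ l : α, (∀ v ∈ ends l, v ∈ S ∨ v = a) ∨ (∀ v ∈ ends l, v ∉ S ∨ v = a)) (haS : a ∉ S)
    (z : α → Bool) {s c : V} (hs : s ∈ S) (hc : c ∉ S) (h : (openGraph (labelledOpen ends z)).Reachable s c) :
    (openGraph (labelledOpen ends z)).Reachable s a ∧ (openGraph (labelledOpen ends z)).Reachable a c := by
  obtain ⟨p⟩ := h
  have ha : a ∈ p.support := by
    by_contra ha
    exact hc (support_subset_of_walk ends a S hsep haS z p hs ha c p.end_mem_support)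
  exact ⟨⟨p.takeUntil a ha⟩, ⟨p.dropUntil a ha⟩⟩

/-- A label carrying an edge between two vertices of `S ∪ {a}` (not both `a`) lies inside `S ∪ {a}`: it is not an outside label. [this work] -/
theorem inside_of_edge (hsep : ∀ l : α, (∀ v ∈ ends l, v ∈ S ∨ v = a) ∨ (∀ v ∈ ends l, v ∉ S ∨ v = a))
    {l : α} {u w : V} (hl : ends l = s(u, w)) (hu : u ∈ S ∨ u = a) (hw : w ∈ S ∨ w = a) (huw : u ≠ w) :
    ∀ v ∈ ends l, v ∈ S ∨ v = a := by
  rcases hsep l with h | h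
  · exact h
  · exfalso
    have hu' := h u (by rw [hl]; exact Sym2.mem_mk_left u w)
    have hw' := h w (by rw [hl]; exact Sym2.mem_mk_right u w)
    rcases hu with hu | rfl
    · rcases hu' with hu' | rfl
      · exact hu' hu
      · rcases hw with hw | rfl
        · rcases hw' with hw' | h2
          · exact hw' hw
          · exact huw h2.symm
        · exact huw rfl
    · rcases hw with hw | rfl
      · rcases hw' with hw' | h2
        · exact hw' hw
        · exact huw h2.symm
      · exact huw rfl

/-- **LOCALITY at the cut vertex.**  If `z'` is open on every `z`-open label inside `S ∪ {a}`, then every `z`-connection from `a` into `S`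
is a `z'`-connection: a path from `a` to `v ∈ S` never leaves `S ∪ {a}` after its first step. [this work] -/
theorem reachable_of_agree_inside [DecidableEq V]
    (hsep : ∀ l : α, (∀ v ∈ ends l, v ∈ S ∨ v = a) ∨ (∀ v ∈ ends l, v ∉ S ∨ v = a)) (haS : a ∉ S)
    {z z' : α → Bool} (hagree : ∀ l, (∀ v ∈ ends l, v ∈ S ∨ v = a) → ¬ (ends l).IsDiag → z l = true → z' l = true)
    {v : V} (hv : v ∈ S ∨ v = a) (h : (openGraph (labelledOpen ends z)).Reachable a v) :
    (openGraph (labelledOpen ends z')).Reachable a v := by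
  rcases hv with hv | rfl
  swap
  · exact SimpleGraph.Reachable.refl _
  obtain ⟨p⟩ := h
  -- pass to a path: `a` occurs only at the start
  set q : (openGraph (labelledOpen ends z)).Walk a v := p.bypass with hq
  have hpath : q.IsPath := p.bypass_isPath
  -- all vertices of `q` lie in `S ∪ {a}`
  have hsupp : ∀ x ∈ q.support, x ∈ S ∨ x = a := by
    cases hq' : q with
    | nil => intro x hx; simp only [SimpleGraph.Walk.support_nil, List.mem_singleton] at hx; exact Or.inr hx
    | cons h r =>
      have hnd := hpath.support_nodup
      rw [hq', SimpleGraph.Walk.support_cons, List.nodup_cons] at hnd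
      -- the remaining walk, reversed, starts at `v ∈ S` and avoids `a`, hence stays in `S`
      have hr : ∀ x ∈ r.reverse.support, x ∈ S :=
        support_subset_of_walk ends a S hsep haS z r.reverse hv (by
          rw [SimpleGraph.Walk.support_reverse, List.mem_reverse]; exact hnd.1)
      intro x hx
      rw [SimpleGraph.Walk.support_cons, List.mem_cons] at hx
      rcases hx with rfl | hx
      · exact Or.inr rfl
      · exact Or.inl (hr x (by rw [SimpleGraph.Walk.support_reverse, List.mem_reverse]; exact hx))
  -- transfer `q` to `z'`
  refine reachable_of_walk_of_labels ends z z' q fun l hl he => ?_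
  have heG := q.edges_subset_edgeSet he
  have hnd : ¬ (ends l).IsDiag := by
    rw [openGraph, SimpleGraph.edgeSet_fromEdgeSet] at heG; exact heG.2
  refine hagree l ?_ hnd hl
  -- both endpoints of `ends l` are on the walk, hence in `S ∪ {a}`
  obtain ⟨u, w, hends⟩ : ∃ u w, ends l = s(u, w) := by
    induction ends l using Sym2.ind with
    | h u w => exact ⟨u, w, rfl⟩
  rw [hends] at he hnd
  have hu := hsupp u (q.fst_mem_support_of_mem_edges he)
  have hw := hsupp w (q.snd_mem_support_of_mem_edges he)
  have huw : u ≠ w := fun h => hnd (by rw [h]; exact Sym2.mk_isDiag_iff.mpr rfl)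
  exact inside_of_edge ends a S hsep hends hu hw huw

/-- **Locality, symmetric form**: configurations that agree on the non-loop labels inside `S ∪ {a}` have the same connections from `a`
into `S ∪ {a}`. [this work] -/
theorem reachable_iff_of_agree_inside [DecidableEq V]
    (hsep : ∀ l : α, (∀ v ∈ ends l, v ∈ S ∨ v = a) ∨ (∀ v ∈ ends l, v ∉ S ∨ v = a)) (haS : a ∉ S)
    {z z' : α → Bool} (hagree : ∀ l, (∀ v ∈ ends l, v ∈ S ∨ v = a) → ¬ (ends l).IsDiag → z l = z' l)
    {v : V} (hv : v ∈ S ∨ v = a) :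
    (openGraph (labelledOpen ends z)).Reachable a v ↔ (openGraph (labelledOpen ends z')).Reachable a v :=
  ⟨reachable_of_agree_inside ends a S hsep haS (fun l hl hd h => (hagree l hl hd) ▸ h) hv,
   reachable_of_agree_inside ends a S hsep haS (fun l hl hd h => (hagree l hl hd).symm ▸ h) hv⟩

/-- The label `l` touches the closed cluster of `a` in the complement `z̄` iff one of its endpoints is joined to `a` in `z`. [this work] -/
theorem qtouch_compl_iff (z : α → Bool) (l : α) :
    QTouch ends a (fun x => !z x) l ↔ ∃ v ∈ ends l, (openGraph (labelledOpen ends z)).Reachable a v := by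
  simp only [QTouch, CReach, Bool.not_not]

/-- **The flat respects the separation**: configurations agreeing on the non-loop labels inside `S ∪ {a}` have flats agreeing there.
[this work] -/
theorem flat_apply_eq_of_agree [DecidableEq V]
    (hsep : ∀ l : α, (∀ v ∈ ends l, v ∈ S ∨ v = a) ∨ (∀ v ∈ ends l, v ∉ S ∨ v = a)) (haS : a ∉ S)
    {z z' : α → Bool} (hagree : ∀ l, (∀ v ∈ ends l, v ∈ S ∨ v = a) → ¬ (ends l).IsDiag → z l = z' l)
    {l : α} (hl : ∀ v ∈ ends l, v ∈ S ∨ v = a) (hd : ¬ (ends l).IsDiag) :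
    clusterFlip ends a (fun x => !z x) l = clusterFlip ends a (fun x => !z' x) l := by
  classical
  have hq : QTouch ends a (fun x => !z x) l ↔ QTouch ends a (fun x => !z' x) l := by
    rw [qtouch_compl_iff, qtouch_compl_iff]
    constructor
    · rintro ⟨v, hv, hr⟩
      exact ⟨v, hv, (reachable_iff_of_agree_inside ends a S hsep haS hagree (hl v hv)).1 hr⟩
    · rintro ⟨v, hv, hr⟩
      exact ⟨v, hv, (reachable_iff_of_agree_inside ends a S hsep haS hagree (hl v hv)).2 hr⟩
  by_cases h : QTouch ends a (fun x => !z x) l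
  · rw [clusterFlip_of_qtouch ends a _ h, clusterFlip_of_qtouch ends a _ (hq.1 h)]
    simp only [hagree l hl hd]
  · rw [clusterFlip_of_not_qtouch ends a _ h, clusterFlip_of_not_qtouch ends a _ (fun h' => h (hq.2 h'))]
    simp only [Bool.not_not, hagree l hl hd]

/-- The 'virtually joined' event `{a ↮ v in z, a ↔ v in ♭z}` for `v ∈ S ∪ {a}` is determined by the non-loop labels inside `S ∪ {a}`.
[this work] -/
theorem virtual_iff_of_agree [DecidableEq V]
    (hsep : ∀ l : α, (∀ v ∈ ends l, v ∈ S ∨ v = a) ∨ (∀ v ∈ ends l, v ∉ S ∨ v = a)) (haS : a ∉ S)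
    {z z' : α → Bool} (hagree : ∀ l, (∀ v ∈ ends l, v ∈ S ∨ v = a) → ¬ (ends l).IsDiag → z l = z' l)
    {v : V} (hv : v ∈ S ∨ v = a) :
    (¬ (openGraph (labelledOpen ends z)).Reachable a v ∧
        (openGraph (labelledOpen ends (clusterFlip ends a fun x => !z x))).Reachable a v) ↔
    (¬ (openGraph (labelledOpen ends z')).Reachable a v ∧
        (openGraph (labelledOpen ends (clusterFlip ends a fun x => !z' x))).Reachable a v) := by
  rw [reachable_iff_of_agree_inside ends a S hsep haS hagree hv,
    reachable_iff_of_agree_inside ends a S hsep haS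
      (z := clusterFlip ends a fun x => !z x) (z' := clusterFlip ends a fun x => !z' x)
      (fun l hl hd => flat_apply_eq_of_agree ends a S hsep haS hagree hl hd) hv]

end Separator

/-! ### 2. The independence count -/

section Independence

variable [Fintype α] [DecidableEq α]

/-- **INDEPENDENCE COUNT.**  If `E₁` is determined by the labels satisfying `ins` and `E₂` by the others, then
`#{E₁ ∧ E₂} · #univ = #{E₁} · #{E₂}` — the bijection `(z, w) ↦ (z|ins ∪ w|insᶜ, w|ins ∪ z|insᶜ)` of pairs. [this work] -/
theorem card_and_mul_card_univ (ins : α → Prop) [DecidablePred ins] (E₁ E₂ : (α → Bool) → Prop)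
    [DecidablePred E₁] [DecidablePred E₂]
    (h₁ : ∀ z z' : α → Bool, (∀ l, ins l → z l = z' l) → E₁ z → E₁ z')
    (h₂ : ∀ z z' : α → Bool, (∀ l, ¬ ins l → z l = z' l) → E₂ z → E₂ z') :
    (univ.filter fun z : α → Bool => E₁ z ∧ E₂ z).card * (univ : Finset (α → Bool)).card =
      (univ.filter E₁).card * (univ.filter E₂).card := by
  rw [← Finset.card_product, ← Finset.card_product]
  let mix : (α → Bool) → (α → Bool) → (α → Bool) := fun z w l => if ins l then z l else w l
  have hin : ∀ z w l, ins l → mix z w l = z l := fun z w l h => by simp [mix, h]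
  have hout : ∀ z w l, ¬ ins l → mix z w l = w l := fun z w l h => by simp [mix, h]
  have hmm : ∀ z w, mix (mix z w) (mix w z) = z := fun z w => by
    funext l; by_cases h : ins l <;> simp [mix, h]
  refine Finset.card_nbij' (fun p => (mix p.1 p.2, mix p.2 p.1)) (fun p => (mix p.1 p.2, mix p.2 p.1)) ?_ ?_ ?_ ?_
  · rintro ⟨z, w⟩ hp
    simp only [Finset.mem_coe, Finset.mem_product, Finset.mem_filter, Finset.mem_univ, true_and, and_true] at hp ⊢
    exact ⟨h₁ z _ (fun l hl => (hin z w l hl).symm) hp.1, h₂ z _ (fun l hl => (hout w z l hl).symm) hp.2⟩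
  · rintro ⟨x, y⟩ hp
    simp only [Finset.mem_coe, Finset.mem_product, Finset.mem_filter, Finset.mem_univ, true_and, and_true] at hp ⊢
    exact ⟨h₁ x _ (fun l hl => (hin x y l hl).symm) hp.1, h₂ y _ (fun l hl => (hout x y l hl).symm) hp.2⟩
  · rintro ⟨z, w⟩ _
    simp only [hmm]
  · rintro ⟨x, y⟩ _
    simp only [hmm]

end Independence

/-! ### 3. The cut-vertex theorem -/

section CutVertex

/-- A pair all of whose members equal `a` is the diagonal pair. [folklore] -/
theorem isDiag_of_forall_eq {a : V} {e : Sym2 V} (h : ∀ v ∈ e, v = a) : e.IsDiag := by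
  induction e using Sym2.ind with
  | h x y =>
    rw [h x (Sym2.mem_mk_left x y), h y (Sym2.mem_mk_right x y)]
    exact Sym2.mk_isDiag_iff.mpr rfl

/-- The separation hypothesis is symmetric: `a` also separates the outside `T = (S ∪ {a})ᶜ` from the rest. [this work] -/
theorem separates_compl (ends : α → Sym2 V) (a : V) (S : Set V)
    (hsep : ∀ l : α, (∀ v ∈ ends l, v ∈ S ∨ v = a) ∨ (∀ v ∈ ends l, v ∉ S ∨ v = a)) :
    ∀ l : α, (∀ v ∈ ends l, v ∈ {v : V | v ∉ S ∧ v ≠ a} ∨ v = a) ∨ (∀ v ∈ ends l, v ∉ {v : V | v ∉ S ∧ v ≠ a} ∨ v = a) := by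
  intro l
  rcases hsep l with h | h
  · right
    intro v hv
    rcases h v hv with h' | h'
    · left; simp only [Set.mem_setOf_eq, not_and, not_not]; exact fun hn => absurd h' hn
    · exact Or.inr h'
  · left
    intro v hv
    by_cases hva : v = a
    · exact Or.inr hva
    · rcases h v hv with h' | h'
      · exact Or.inl ⟨h', hva⟩
      · exact absurd h' hva

variable [Fintype α] [DecidableEq α] [DecidableEq V]

open Classical in
/-- **THE CUT-VERTEX THEOREM (CONJECTURE (P) when the apex separates `s` from `c`).**  On a finite multigraph `(V, α, ends)` in which every
label lies inside `S ∪ {a}` or outside `S` (`a ∉ S`), for `s ∈ S` and `c ∉ S`: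
`#{z : a ↮ s, a ↮ c, s ↮ c in z, s ↔ c in ♭z}² ≤ #{z : a ↔ s, a ↮ c} · #{z : a ↔ c, a ↮ s}` with `♭z = clusterFlip ends a z̄`. [this work] -/
theorem productForm_of_separates (ends : α → Sym2 V) (a s c : V) (S : Set V)
    (hsep : ∀ l : α, (∀ v ∈ ends l, v ∈ S ∨ v = a) ∨ (∀ v ∈ ends l, v ∉ S ∨ v = a))
    (haS : a ∉ S) (hs : s ∈ S) (hcS : c ∉ S) (hca : c ≠ a) :
    (univ.filter fun z : α → Bool =>
        (¬ (openGraph (labelledOpen ends z)).Reachable a s ∧ ¬ (openGraph (labelledOpen ends z)).Reachable a c ∧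
          ¬ (openGraph (labelledOpen ends z)).Reachable s c) ∧
        (openGraph (labelledOpen ends (clusterFlip ends a fun l => !z l))).Reachable s c).card ^ 2 ≤
    (univ.filter fun z : α → Bool =>
        (openGraph (labelledOpen ends z)).Reachable a s ∧ ¬ (openGraph (labelledOpen ends z)).Reachable a c).card *
    (univ.filter fun z : α → Bool =>
        (openGraph (labelledOpen ends z)).Reachable a c ∧ ¬ (openGraph (labelledOpen ends z)).Reachable a s).card := by
  -- the outside of the separator
  set T : Set V := {v : V | v ∉ S ∧ v ≠ a} with hT
  have hsepT := separates_compl ends a S hsep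
  have haT : a ∉ T := fun h => h.2 rfl
  have hcT : c ∈ T := ⟨hcS, hca⟩
  -- inside labels: non-loop labels within `S ∪ {a}`
  let ins : α → Prop := fun l => (∀ v ∈ ends l, v ∈ S ∨ v = a) ∧ ¬ (ends l).IsDiag
  -- agreement on `ins` gives the inside agreement hypothesis; agreement off `ins` gives the outside one
  have hagS : ∀ z z' : α → Bool, (∀ l, ins l → z l = z' l) →
      ∀ l, (∀ v ∈ ends l, v ∈ S ∨ v = a) → ¬ (ends l).IsDiag → z l = z' l :=
    fun z z' h l hl hd => h l ⟨hl, hd⟩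
  have hagT : ∀ z z' : α → Bool, (∀ l, ¬ ins l → z l = z' l) →
      ∀ l, (∀ v ∈ ends l, v ∈ T ∨ v = a) → ¬ (ends l).IsDiag → z l = z' l := by
    intro z z' h l hl hd
    refine h l fun hins => hd (isDiag_of_forall_eq (a := a) fun v hv => ?_)
    rcases hins.1 v hv with h1 | h1
    · rcases hl v hv with h2 | h2
      · exact absurd h1 h2.1
      · exact h2
    · exact h1
  -- the bad set is the intersection of the two 'virtually joined' events
  have hbad_eq : (univ.filter fun z : α → Bool =>
        (¬ (openGraph (labelledOpen ends z)).Reachable a s ∧ ¬ (openGraph (labelledOpen ends z)).Reachable a c ∧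
          ¬ (openGraph (labelledOpen ends z)).Reachable s c) ∧
        (openGraph (labelledOpen ends (clusterFlip ends a fun l => !z l))).Reachable s c) =
      (univ.filter fun z : α → Bool =>
        (¬ (openGraph (labelledOpen ends z)).Reachable a s ∧
          (openGraph (labelledOpen ends (clusterFlip ends a fun l => !z l))).Reachable a s) ∧
        (¬ (openGraph (labelledOpen ends z)).Reachable a c ∧
          (openGraph (labelledOpen ends (clusterFlip ends a fun l => !z l))).Reachable a c)) := by
    refine Finset.filter_congr fun z _ => ?_
    constructor
    · rintro ⟨⟨h1, h2, h3⟩, h4⟩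
      have hsplit := reachable_apex_of_reachable ends a S hsep haS (clusterFlip ends a fun l => !z l) hs hcS h4
      exact ⟨⟨h1, hsplit.1.symm⟩, ⟨h2, hsplit.2⟩⟩
    · rintro ⟨⟨h1, h1'⟩, ⟨h2, h2'⟩⟩
      refine ⟨⟨h1, h2, fun h3 => h1 ?_⟩, h1'.symm.trans h2'⟩
      exact (reachable_apex_of_reachable ends a S hsep haS z hs hcS h3).1.symm
  -- `P2` with its two conditions swapped
  have hP2_eq : (univ.filter fun z : α → Bool =>
        (openGraph (labelledOpen ends z)).Reachable a c ∧ ¬ (openGraph (labelledOpen ends z)).Reachable a s) =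
      (univ.filter fun z : α → Bool =>
        ¬ (openGraph (labelledOpen ends z)).Reachable a s ∧ (openGraph (labelledOpen ends z)).Reachable a c) :=
    Finset.filter_congr fun z _ => and_comm
  -- the three independence counts
  have hIbad := card_and_mul_card_univ ins
    (fun z => ¬ (openGraph (labelledOpen ends z)).Reachable a s ∧
      (openGraph (labelledOpen ends (clusterFlip ends a fun l => !z l))).Reachable a s)
    (fun z => ¬ (openGraph (labelledOpen ends z)).Reachable a c ∧
      (openGraph (labelledOpen ends (clusterFlip ends a fun l => !z l))).Reachable a c)
    (fun z z' h hz => (virtual_iff_of_agree ends a S hsep haS (hagS z z' h) (Or.inl hs)).1 hz)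
    (fun z z' h hz => (virtual_iff_of_agree ends a T hsepT haT (hagT z z' h) (Or.inl hcT)).1 hz)
  have hIP1 := card_and_mul_card_univ ins
    (fun z => (openGraph (labelledOpen ends z)).Reachable a s)
    (fun z => ¬ (openGraph (labelledOpen ends z)).Reachable a c)
    (fun z z' h hz => (reachable_iff_of_agree_inside ends a S hsep haS (hagS z z' h) (Or.inl hs)).1 hz)
    (fun z z' h hz => fun h' => hz ((reachable_iff_of_agree_inside ends a T hsepT haT (hagT z z' h) (Or.inl hcT)).2 h'))
  have hIP2 := card_and_mul_card_univ ins
    (fun z => ¬ (openGraph (labelledOpen ends z)).Reachable a s)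
    (fun z => (openGraph (labelledOpen ends z)).Reachable a c)
    (fun z z' h hz => fun h' => hz ((reachable_iff_of_agree_inside ends a S hsep haS (hagS z z' h) (Or.inl hs)).2 h'))
    (fun z z' h hz => (reachable_iff_of_agree_inside ends a T hsepT haT (hagT z z' h) (Or.inl hcT)).1 hz)
  beta_reduce at hIbad hIP1 hIP2
  -- the two-point facts on each side
  have e1F := card_virtual_le_card_conn ends a s
  have e1G := card_virtual_le_card_disc ends a s
  have e2F := card_virtual_le_card_conn ends a c
  have e2G := card_virtual_le_card_disc ends a c
  rw [hbad_eq, hP2_eq]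
  -- abbreviate the cardinalities
  set U := (univ : Finset (α → Bool)).card with hU
  set B := (univ.filter fun z : α → Bool =>
        (¬ (openGraph (labelledOpen ends z)).Reachable a s ∧
          (openGraph (labelledOpen ends (clusterFlip ends a fun l => !z l))).Reachable a s) ∧
        (¬ (openGraph (labelledOpen ends z)).Reachable a c ∧
          (openGraph (labelledOpen ends (clusterFlip ends a fun l => !z l))).Reachable a c)).card with hB
  set E1 := (univ.filter fun z : α → Bool => ¬ (openGraph (labelledOpen ends z)).Reachable a s ∧
        (openGraph (labelledOpen ends (clusterFlip ends a fun l => !z l))).Reachable a s).card with hE1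
  set E2 := (univ.filter fun z : α → Bool => ¬ (openGraph (labelledOpen ends z)).Reachable a c ∧
        (openGraph (labelledOpen ends (clusterFlip ends a fun l => !z l))).Reachable a c).card with hE2
  set F1 := (univ.filter fun z : α → Bool => (openGraph (labelledOpen ends z)).Reachable a s).card with hF1
  set G1 := (univ.filter fun z : α → Bool => ¬ (openGraph (labelledOpen ends z)).Reachable a s).card with hG1
  set F2 := (univ.filter fun z : α → Bool => (openGraph (labelledOpen ends z)).Reachable a c).card with hF2
  set G2 := (univ.filter fun z : α → Bool => ¬ (openGraph (labelledOpen ends z)).Reachable a c).card with hG2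
  set Q1 := (univ.filter fun z : α → Bool =>
        (openGraph (labelledOpen ends z)).Reachable a s ∧ ¬ (openGraph (labelledOpen ends z)).Reachable a c).card with hQ1
  set Q2 := (univ.filter fun z : α → Bool =>
        ¬ (openGraph (labelledOpen ends z)).Reachable a s ∧ (openGraph (labelledOpen ends z)).Reachable a c).card with hQ2
  have hUpos : 0 < U := Finset.card_pos.mpr Finset.univ_nonempty
  have key : B * U * (B * U) ≤ Q1 * U * (Q2 * U) := by
    rw [hIbad, hIP1, hIP2]
    calc E1 * E2 * (E1 * E2) = (E1 * E1) * (E2 * E2) := by ring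
      _ ≤ (F1 * G1) * (G2 * F2) := Nat.mul_le_mul (Nat.mul_le_mul e1F e1G) (Nat.mul_le_mul e2G e2F)
      _ = F1 * G2 * (G1 * F2) := by ring
  have key' : B ^ 2 * (U * U) ≤ Q1 * Q2 * (U * U) := by
    calc B ^ 2 * (U * U) = B * U * (B * U) := by ring
      _ ≤ Q1 * U * (Q2 * U) := key
      _ = Q1 * Q2 * (U * U) := by ring
  exact Nat.le_of_mul_le_mul_right key' (Nat.mul_pos hUpos hUpos)

end CutVertex

end Summit.CriticalPhenomena.PercolationContinuityZ3.Theorems.ProductFormFibre
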